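import Literature.IUT.HodgeTheaters.ProfiniteCompletionFreeAbelianTorsionFree
import Literature.IUT.HodgeTheaters.TemperedCoveringsFreeModel
import HarnessLib

/-!
# [IUTchI] Prop. 2.4 (i), sub-node (L2a) HOLDS at the §2 consistency model `F₂ ↪ F̂₂`

Mochizuki, *Inter-universal Teichmüller theory I*, kurims manuscript (May 2020), §2, proof of Prop. 2.4 (i),
p. 50 l. 27 ("`Δ̂_X` is strongly torsion-free") [cite: Mochizuki2012, Prop 2.4(i) p.50] (D-0012 claim key;
nothing of the series is asserted here).  PROOF-ONLY file (seat abc-iut-w4-d055): the typed sub-node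
`StableCurveTemperedData.StronglyTorsionFreeSigma` (abc-iut-w5-d119, plan/L5/SUBDAG-IUTchI-Prop24.md row
P24i.r4) is TRUE at abc-iut-L5-d4's consistency datum `StableCurveTemperedData.FreeModel.toy`
(`Π^tp_X = F₂ ↪ F̂₂ = Π̂_X`, `G_k = 1`, so `Δ̂_X = F̂₂`): an instance of
`stronglyTorsionFreeSigma_of_mulEquiv_profiniteCompletion` (p418155) at `G := F₂`.  Non-vacuity + truth at
the model of the reduction chain p417014 → p418155 → p418966; no new definition; nothing here bears on
[IUTchIII] Cor. 3.12.
-/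

namespace Literature.IUT.HodgeTheaters

namespace StableCurveTemperedData

namespace FreeModel

/-- `F₂` (the type synonym of the model) is a free group. [folklore] -/
private theorem isFreeGroup_F2 : IsFreeGroup F2 := inferInstanceAs (IsFreeGroup (FreeGroup (Fin 2)))

/-- `F₂` is finitely generated. [folklore] -/
private theorem fg_F2 : Group.FG F2 := inferInstanceAs (Group.FG (FreeGroup (Fin 2)))

/-- **(L2a) at the consistency model**: `StronglyTorsionFreeSigma` holds for the datum `toy`
(`Δ̂_X = F̂₂`, the profinite completion of the free group on two letters).
[cite: Mochizuki2012, Prop 2.4(i) p.50] -/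
theorem toy_stronglyTorsionFreeSigma : toy.StronglyTorsionFreeSigma := by
  haveI : IsFreeGroup F2 := isFreeGroup_F2
  haveI : Group.FG F2 := fg_F2
  -- `Δ̂_X = Ker(1 : F̂₂ → G_k)` is all of `F̂₂`
  have hmem : ∀ x : Hat, x ∈ toy.DeltaHat := fun x => by
    change x ∈ (1 : Hat →* Gk).ker
    rw [MonoidHom.ker_one]; trivial
  have hΔc : toy.DeltaHatClosed := by
    have e : ((toy.DeltaHat : Subgroup Hat) : Set Hat) = Set.univ :=
      Set.eq_univ_of_forall fun x => hmem x
    change IsClosed ((toy.DeltaHat : Subgroup Hat) : Set Hat)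
    rw [e]; exact isClosed_univ
  -- the identification `Δ̂_X ≃ₜ* F̂₂`
  let e : toy.DeltaHat ≃* profiniteCompletion F2 :=
    { toFun := fun z => z.1
      invFun := fun x => ⟨x, hmem x⟩
      left_inv := fun z => rfl
      right_inv := fun x => rfl
      map_mul' := fun z z' => rfl }
  let eₜ : toy.DeltaHat ≃ₜ* profiniteCompletion F2 :=
    { e with
      continuous_toFun := continuous_subtype_val
      continuous_invFun := Continuous.subtype_mk continuous_id _ }
  exact stronglyTorsionFreeSigma_of_mulEquiv_profiniteCompletion hΔc eₜ

end FreeModel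

end StableCurveTemperedData

end Literature.IUT.HodgeTheaters
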